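import Summits.HodgeConjecture.HodgeConjecture.Theorems.HeckePrymWeilAimedDescendingOfAimedSplitProduct
import Literature.AlgebraicGeometry.Motives.AimedSplitProductDischarge
import HarnessLib

/-!
# Route `HeckePrymWeil` · support item `AimedDescending` (stmt-HodgeConjecture-14643) — CLOSED

The aimed component descent (Markman arXiv:2509.23403 §11.5 Step 2; Schoen 1998 §10; Koike 2004
Thm 2.1), every prime `p ≡ 3 (4)`, `p ≥ 7`, every `n ≥ 1`: IF the Hodge–Weil classes are algebraic on
every SPLIT (hyperbolic) `ℚ(√-p)`-Weil abelian `(2n+2)`-fold THEN they are algebraic on EVERY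
`ℚ(√-p)`-Weil abelian `2n`-fold.  The item's prover seat proved it modulo the single named fact
`Motives.exists_cmWeilSurface_aimedSplitProduct_of_ne_one_of_ne_three`
(`aimedDescending_of_aimedSplitProduct`, p98653); that fact is now DISCHARGED in the tree
(`Motives.exists_cmWeilSurface_aimedSplitProduct_of_ne_one_of_ne_three_holds`, file
`Motives/AimedSplitProductDischarge`: the CM square `E₀ × E₀` with `([√-d], -[√-d])`, Hodge–Riemann in
degree one, the weighted Segre hyperplane class).  This file composes the two — found while running
the CM-anchor ladder of crux `WeilTwelvefoldsSqrtMinus7` (stmt-1261, lead seat c3), whose reach step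
uses the same aiming theorem.  No `sorry`, no hypothesis.
-/

noncomputable section

-- single-problem summit (Problem = Summit): the mandated namespace repeats `HodgeConjecture`.
set_option linter.dupNamespace false

namespace Summit.HodgeConjecture.HodgeConjecture.Theorems

/-- **`AimedDescending` (stmt-HodgeConjecture-14643) holds**: the aimed component descent for every
prime `p ≡ 3 (4)`, `p ≥ 7` and every `n ≥ 1` — `aimedDescending_of_aimedSplitProduct` fed with the
discharged aiming fact `Motives.exists_cmWeilSurface_aimedSplitProduct_of_ne_one_of_ne_three_holds`.
[cite: Markman2025SurveySecant, §11.5 Step 2] [cite: Schoen1998HodgeWeilAddendum, §10 (Proposition and proof)]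
[cite: vanGeemen1994HodgeAV, Lemma 5.2 (3), 5.3 and 5.4 (5.4.1)] -/
theorem aimedDescending_proof :
    Summit.HodgeConjecture.HodgeConjecture.Theses.HeckePrymWeil.AimedDescending :=
  aimedDescending_of_aimedSplitProduct
    Literature.AlgebraicGeometry.Motives.exists_cmWeilSurface_aimedSplitProduct_of_ne_one_of_ne_three_holds

end Summit.HodgeConjecture.HodgeConjecture.Theorems

end
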